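import Summits.BirchSwinnertonDyer.BirchSwinnertonDyer.Theorems.TwoAdicConverseOrdLambdaHalfAtTwoGreenbergCotorsionCyclotomic
import Literature.NumberTheory.EllipticCurves.SelmerTorsionRestriction
import Literature.NumberTheory.EllipticCurves.DivisionFieldRamificationDividesProofs
import HarnessLib

/-!
# Route `TwoAdicConverse` (rung S3), crux `OrdLambdaHalfAtTwo` (item stmt-BirchSwinnertonDyer-19556), line
# `kato-determinant-greenberg-two`: the STABLE LINE of habitat (β) over the Greenberg field, and B2 on (β) from ONE
# displayed `GL(1)` input

Cell `bsd-2adic`, seat `bsd-2adic-conv-1` GEN 25 (`--supports` stmt-BirchSwinnertonDyer-19556; helper; route-independent imports).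
Fourth file of the B2 spine (after `…GreenbergCotorsionOfResidual` p658418, `…OrderTwo` p658794, `…Cyclotomic` p659144).
Those files reduce B2 («the Greenberg strict-at-`w` / relaxed dual `X_Gr` of `E[2^∞]` over the cyclotomic `ℤ₂`-tower of `K`
is `Λ`-finitely generated, `Λ`-torsion, `μ = 0`») to two residual inputs: (R2) a `Γ_K`-stable LINE `Φ ≤ E_K[2]` and (R3) the
finiteness of the residual Castella Selmer group `R_w^Σ(K_∞, Φ)` of the trivial module `Φ ≅ 𝔽₂`.  This file DISCHARGES (R2) on
the line's habitat (β) = «`E[2]` reducible over `ℚ`» (`¬ W.HasIrreducibleModPGaloisRep 2`, a rational point of order `2`), for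
ANY field `K/ℚ`:

* **`exists_stableLine_baseChange_of_not_irreducible_two`** — (R2): if `E[2]` is reducible over `ℚ` then for every number
  field `K` there is a `Γ_K`-stable `Φ ≤ E_K[2]` (tree `StableSubgroup`) with `#Φ = 2`: a proper non-trivial stable subgroup
  of `E[2](ℚ̄)` (order `4`, tree `natCard_geomTorsion_prime_eq_sq`) has order `2` (Lagrange), and its image under the tree's
  injective, `resGal`-equivariant base-change map `torsionBaseChangeMap W K 2 : E[2](ℚ̄) → E_K[2](K̄)` is `Γ_K`-stable of
  the same order;
* **`greenbergStrictSelmerDual_finite_torsion_mu_on_beta_of_GL1`** — B2 ON (β) FROM ONE DISPLAYED INPUT: for `W/ℚ` with `E[2]`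
  reducible, any number field `K`, the cyclotomic `ℤ₂`-extension `κ` with topological generator `γ`, a place `w ∣ 2`, and a
  set `Σ` containing the bad places of `E_K` prime to `2`: IF the residual Castella Selmer group `R_w^Σ(K_∞, M)` is finite for
  every `Γ_K`-module `M` of order `2` carried by a stable line of `E_K[2]` (hypothesis `hGL1`, the (R3) input = classical
  `GL(1)` Iwasawa theory of `K` at `2`: Ferrero–Washington `μ = 0` for the abelian field `K` + reciprocity; NOT proved here),
  THEN every Pontryagin-dual datum of the Greenberg Selmer group of `E_K[2^∞]` over `K_∞` is `Λ`-f.g., `Λ`-torsion, `μ = 0`.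

HONEST FRAMING.  Group theory + composition of tree theorems; no definition, no named fact, no `sorry`; the (R3) input
is a displayed hypothesis; nothing about any particular curve is asserted; BSD is not proved by any of this.
PARTITION (D-0054): none — RANK axis S3 × X5@2 stratum (β); types-the-object-of (the stable line of the (β)-dévissage).

References: J. H. Silverman, *AEC* III.6.4, III.§7 [SilvermanAEC2009]; J.-P. Serre, *Galois Cohomology* I.§2.4, II.§1.1
[SerreGaloisCohomology1997]; R. Greenberg, V. Vatsal, Invent. Math. 142 (2000) §2 p. 28 [GreenbergVatsal2000];
F. Castella, G. Grossi, J. Lee, C. Skinner, Invent. Math. 227 (2022) §1.4 [CastellaGrossiLeeSkinner2022].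
-/

set_option linter.dupNamespace false
set_option autoImplicit false

noncomputable section

open scoped Classical

namespace Summit.BirchSwinnertonDyer.BirchSwinnertonDyer.Theorems.TwoAdicGreenbergCotorsion

open NumberField IsDedekindDomain Field WeierstrassCurve
open Literature.NumberTheory.EllipticCurves Literature.NumberTheory.EllipticCurves.GreenbergSelmer
  Literature.NumberTheory.EllipticCurves.GreenbergVatsal2000 Literature.NumberTheory.GaloisRepresentations
  Summit.BirchSwinnertonDyer.Rank1Residual.X11b Summit.BirchSwinnertonDyer.Rank1Residual.X11b.AcSelmer
  Summit.BirchSwinnertonDyer.Rank1Residual.X2.ResidualDevissageModules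

/-! ## §1 (R2): the stable line of habitat (β) -/

section Beta

variable (W : WeierstrassCurve ℚ) [W.IsElliptic]

/-- A proper non-trivial subgroup of a group of order `4` has order `2` (Lagrange). [folklore] -/
theorem natCard_eq_two_of_ne_bot_of_ne_top {A : Type*} [AddCommGroup A] (hA : Nat.card A = 4) (H : AddSubgroup A)
    (hb : H ≠ ⊥) (ht : H ≠ ⊤) : Nat.card H = 2 := by
  haveI : Finite A := Nat.finite_of_card_ne_zero (by rw [hA]; norm_num)
  have hdvd : Nat.card H ∣ 4 := hA ▸ H.card_addSubgroup_dvd_card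
  have hne1 : Nat.card H ≠ 1 := fun h ↦ hb (H.eq_bot_of_card_eq h)
  have hne4 : Nat.card H ≠ 4 := fun h ↦ ht (H.eq_top_of_card_eq (by rw [h, hA]))
  have hle : Nat.card H ≤ 4 := Nat.le_of_dvd (by norm_num) hdvd
  interval_cases h : Nat.card H <;> simp_all

/-- **Habitat (β) over `ℚ` gives a rational line**: `E[2]` reducible ⟹ a `Γ_ℚ`-stable subgroup of `E[2](ℚ̄)` of order `2`.
[cite: SilvermanAEC2009, III.§7] -/
theorem exists_stable_natCard_eq_two_of_not_irreducible_two (hred : ¬ W.HasIrreducibleModPGaloisRep 2) :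
    ∃ H : AddSubgroup (W.geomTorsion ((2 : ℕ) : ℤ)),
      (∀ σ : absoluteGaloisGroup ℚ, ∀ P ∈ H, σ • P ∈ H) ∧ Nat.card H = 2 := by
  unfold WeierstrassCurve.HasIrreducibleModPGaloisRep at hred
  push Not at hred
  obtain ⟨H, hH, hb, ht⟩ := hred
  have h4 : Nat.card (W.geomTorsion ((2 : ℕ) : ℤ)) = 4 := by
    rw [W.natCard_geomTorsion_prime_eq_sq Nat.prime_two]; norm_num
  exact ⟨H, hH, natCard_eq_two_of_ne_bot_of_ne_top h4 H hb ht⟩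

/-- **(R2) The stable line of habitat (β) over the Greenberg field.**  If `E[2]` is reducible over `ℚ` (a rational point of order
`2`), then over EVERY number field `K` the base change `E_K` carries a `Γ_K`-stable subgroup `Φ ≤ E_K[2](K̄)` with `#Φ = 2`
(the image of the rational line; on it `Γ_K` acts trivially, `smul_eq_self_of_natCard_eq_two`). [cite: GreenbergVatsal2000, §2 p. 28] -/
theorem exists_stableLine_baseChange_of_not_irreducible_two (hred : ¬ W.HasIrreducibleModPGaloisRep 2)
    (K : Type) [Field K] [NumberField K] :
    ∃ Φ : StableSubgroup (absoluteGaloisGroup K) ((W.baseChange K).geomTorsion (2 : ℤ)), Nat.card Φ.Sub = 2 := by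
  obtain ⟨H, hH, h2⟩ := exists_stable_natCard_eq_two_of_not_irreducible_two W hred
  -- the image of `H` under the (injective, `resGal`-equivariant) base-change map on `2`-torsion (tree `torsionBaseChangeMap`)
  refine ⟨⟨H.map (torsionBaseChangeMap W K ((2 : ℕ) : ℤ)), fun τ Q hQ ↦ ?_⟩, ?_⟩
  · obtain ⟨P, hP, rfl⟩ := AddSubgroup.mem_map.mp hQ
    exact AddSubgroup.mem_map.mpr ⟨resGal (K := ℚ) K τ • P, hH _ P hP, torsionBaseChangeMap_smul W K _ τ P⟩
  · change Nat.card ↥(H.map (torsionBaseChangeMap W K ((2 : ℕ) : ℤ))) = 2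
    exact (Nat.card_congr (H.equivMapOfInjective _ (torsionBaseChangeMap_injective W K _)).symm.toEquiv).trans h2

end Beta

/-! ## §2 B2 on (β) from ONE displayed `GL(1)` input -/

section B2

variable (W : WeierstrassCurve ℚ) [W.IsElliptic] {K : Type} [Field K] [NumberField K]

/-- **B2 ON HABITAT (β) FROM ONE DISPLAYED `GL(1)` INPUT.**  `W/ℚ` elliptic with `E[2]` reducible; `K` any number field
(the line: a Greenberg field); `κ` the CYCLOTOMIC `ℤ₂`-extension of `K` with topological generator `γ`; `w ∣ 2`; `Σ ⊇` the bad
places of `E_K` prime to `2`.  INPUT `hGL1` (= R3, classical `GL(1)` Iwasawa theory of `K` at `2`, NOT proved here): for every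
`Γ_K`-stable line `Φ ≤ E_K[2]` (a module of order `2`, trivial action) the residual Castella Selmer group `R_w^Σ(K_∞, Φ)` —
continuous quadratic characters of `Gal(K̄/K_∞)` unramified outside `Σ ∪ {v ∣ 2, v ≠ w}` and trivial on every decomposition
group above `w` — is finite.  OUTPUT (B2): every Pontryagin-dual datum `D` of the Greenberg (strict at `w`, relaxed elsewhere
above `2`) Selmer group of `E_K[2^∞]` over `K_∞` is finitely generated over `Λ = ℤ₂⟦T⟧`, `Λ`-torsion, with `μ(D.X) = 0`.
Composition: (R2) `exists_stableLine_baseChange_of_not_irreducible_two` + p659144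
`greenbergStrictSelmerDual_finite_torsion_mu_of_residual_cyclotomic_two`.
[cite: CastellaGrossiLeeSkinner2022, §1.4 Props. 17–18] [cite: GreenbergLNM1716, §1 p. 60] -/
theorem greenbergStrictSelmerDual_finite_torsion_mu_on_beta_of_GL1 (hred : ¬ W.HasIrreducibleModPGaloisRep 2)
    (κ : ZpExtension K 2) (hκ : κ.IsCyclotomic) {γ : absoluteGaloisGroup K} (hγ : κ.IsTopGenerator γ)
    {w : HeightOneSpectrum (𝓞 K)} (hw : ((2 : ℕ) : 𝓞 K) ∈ w.asIdeal)
    {S : Set (HeightOneSpectrum (𝓞 K))}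
    (hS : ∀ v : HeightOneSpectrum (𝓞 K), v ∉ S → ((2 : ℕ) : 𝓞 K) ∉ v.asIdeal → (W.baseChange K).HasGoodReductionAt v)
    (hGL1 : ∀ Φ : StableSubgroup (absoluteGaloisGroup K) ((W.baseChange K).geomTorsion (2 : ℤ)), Nat.card Φ.Sub = 2 →
      (datumStrictSelmer κ.kerSubgroup Φ.Sub 2 (AcSelmer.bdpData Φ.Sub 2 w) S :
        Set (Literature.NumberTheory.EllipticCurves.subgroupH1 κ.kerSubgroup Φ.Sub)).Finite)
    (D : (W.baseChange K).GreenbergStrictSelmerDualData κ γ (AcSelmer.bdpData _ 2 w)) :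
    Module.Finite (IwasawaAlgebra 2) D.X ∧ Module.IsTorsion (IwasawaAlgebra 2) D.X ∧ muInvariant 2 D.X = 0 := by
  haveI : (W.baseChange K).IsElliptic := inferInstanceAs (W.map (algebraMap ℚ K)).IsElliptic
  obtain ⟨Φ, hΦ2⟩ := exists_stableLine_baseChange_of_not_irreducible_two W hred K
  exact greenbergStrictSelmerDual_finite_torsion_mu_of_residual_cyclotomic_two (W.baseChange K) κ hκ hγ hw hS Φ hΦ2
    (hGL1 Φ hΦ2) D

end B2

end Summit.BirchSwinnertonDyer.BirchSwinnertonDyer.Theorems.TwoAdicGreenbergCotorsion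

end
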